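import Summits.AtomisticToContinuum.HydrodynamicLimit.Theorems.InformationPercolationEngineChaosClosesEulerReductionClassical
import HarnessLib

/-!
# Kinetic reduction (crux `ChaosClosesEuler`, stmt-AtomisticToContinuum-15141, line `Sketch`,
# stub `stub_kineticReduction`) — helper: levels, thresholds and the classical moduli in the thresholds' format

WHAT. Small glue for the final assembly of the kinetic reduction:

* `exists_levels` — the guard `η₀`, the cap tolerance `ηcap` and the cut-off levels `ηg < ηg2` are read off the band
  edges of the inputs (collision rate, weak stress isotropy, collisional pressure, the analyticity radius of the
  hard-sphere law, the band edge `η₁` of the extended equation of state);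
* `exists_pos_le₈` — one positive level below eight;
* `shift_moduli`, `space_modulus` — the joint modulus of continuity of the classical fields (`classical_data`) in
  the format of the shift moduli `hωu … hωθx` and the space modulus `hωx` of `reduction_thresholds_cold`;
* `Mmom_eq_integral`, `rhoC_eq_integral`, `momC_eq_integral` — the second velocity moment of the thresholds (a finite
  sum), the cone density and the cone momentum as integrals against the empirical measure with the cone kernel spelled
  out (the format of `WeakStressIsotropyInBand`).

No named fact is invoked.
-/

noncomputable section

namespace Summit.AtomisticToContinuum.HydrodynamicLimit.Theorems.ChaosClosesEulerKineticReduction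

open scoped BigOperators Topology Classical MeasureTheory InnerProductSpace ENNReal
open Filter Set MeasureTheory Function
open Literature.MathematicalPhysics.KineticTheory
open Literature.Analysis.FluidPDE
open Literature.Analysis.FunctionSpaces
open Summit.AtomisticToContinuum.HydrodynamicLimit.Theorems.LocalSecondLawNegative
open Summit.AtomisticToContinuum.HydrodynamicLimit.Theorems.LocalSecondLawLedger
open Summit.AtomisticToContinuum.HydrodynamicLimit.Theorems.LocalSecondLawLedger.L (Mmom)

/-! ## §1 Levels -/

/-- **Registered sub-goal `stub_reductionFinalB` (helper of `stub_kineticReduction`): one positive level below eight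
positive levels.** [folklore] -/
theorem stub_reductionFinalB : ∀ {a b c d e f g h : ℝ}, 0 < a → 0 < b → 0 < c → 0 < d → 0 < e → 0 < f → 0 < g → 0 < h → ∃ s : ℝ, 0 < s ∧ s ≤ a ∧ s ≤ b ∧ s ≤ c ∧ s ≤ d ∧ s ≤ e ∧ s ≤ f ∧ s ≤ g ∧ s ≤ h := by
  intro a b c d e f g h ha hb hc hd he hf hg hh
  refine ⟨min (min (min a b) (min c d)) (min (min e f) (min g h)), by positivity, ?_, ?_, ?_, ?_, ?_, ?_, ?_, ?_⟩
  · exact ((min_le_left _ _).trans (min_le_left _ _)).trans (min_le_left _ _)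
  · exact ((min_le_left _ _).trans (min_le_left _ _)).trans (min_le_right _ _)
  · exact ((min_le_left _ _).trans (min_le_right _ _)).trans (min_le_left _ _)
  · exact ((min_le_left _ _).trans (min_le_right _ _)).trans (min_le_right _ _)
  · exact ((min_le_right _ _).trans (min_le_left _ _)).trans (min_le_left _ _)
  · exact ((min_le_right _ _).trans (min_le_left _ _)).trans (min_le_right _ _)
  · exact ((min_le_right _ _).trans (min_le_right _ _)).trans (min_le_left _ _)
  · exact ((min_le_right _ _).trans (min_le_right _ _)).trans (min_le_right _ _)

/-- **The levels of the reduction.** From the band edges `ηC, ηW, ηP` of the in-band inputs, the half analyticity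
radius `ηE` and the band edge `η₁` of the extended law: cut-off levels `ηg < ηg2` below every edge, guard `η₀` and cap
tolerance `ηcap` with `η₀, ηcap ≤ ηg/2`, `η₀ + ηcap ≤ η₁`, `η₀ ≤ η₁/2`. [folklore] -/
theorem exists_levels {ηC ηW ηP ηE η₁ : ℝ} (hC : 0 < ηC) (hW : 0 < ηW) (hP : 0 < ηP) (hE : 0 < ηE) (h₁ : 0 < η₁) :
    ∃ ηg2 ηg η₀ ηcap : ℝ, 0 < η₀ ∧ 0 < ηcap ∧ ηg < ηg2 ∧ η₀ ≤ ηg / 2 ∧ ηcap ≤ ηg / 2 ∧ η₀ + ηcap ≤ η₁ ∧ η₀ ≤ η₁ / 2 ∧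
      ηg2 ≤ ηC ∧ ηg2 ≤ ηW ∧ ηg2 ≤ ηP ∧ ηg2 ≤ ηE := by
  obtain ⟨s, hs, hsC, hsW, hsP, hsE, hs₁, -, -, -⟩ := stub_reductionFinalB hC hW hP hE h₁ h₁ h₁ h₁
  exact ⟨s, s / 2, s / 4, s / 4, by positivity, by positivity, by linarith, by linarith, by linarith, by linarith,
    by linarith, hsC, hsW, hsP, hsE⟩

/-! ## §2 The classical moduli in the thresholds' format -/

/-- **Shift moduli.** The joint modulus of continuity of the six classical fields on the strip `[0, b₀]`
(`classical_data`) at radius `d`, read at the pairs `(s + e, s)`, `0 < e < d`, `s ∈ [0, L]`, `L + e ≤ b₀`. [folklore] -/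
theorem shift_moduli {T : ℝ} {u : ℝ → T3 → V3} {θ : ℝ → T3 → ℝ} {b₀ ω d e L : ℝ}
    (H : ∀ s ∈ Icc 0 b₀, ∀ s' ∈ Icc 0 b₀, |s - s'| < d → ∀ x y : T3, Torus.euclidDist x y < d →
      ‖u s x - u s' y‖ ≤ ω ∧
      ‖Torus.timeDerivWithin (Ico 0 T) u s x - Torus.timeDerivWithin (Ico 0 T) u s' y‖ ≤ ω ∧
      (∀ i j : Fin 3, |Torus.partialDeriv j (fun y => u s y i) x - Torus.partialDeriv j (fun y' => u s' y' i) y| ≤ ω) ∧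
      |θ s x - θ s' y| ≤ ω ∧
      |Torus.timeDerivWithin (Ico 0 T) θ s x - Torus.timeDerivWithin (Ico 0 T) θ s' y| ≤ ω ∧
      ‖Torus.gradient (θ s) x - Torus.gradient (θ s') y‖ ≤ ω)
    (hd : 0 < d) (he : 0 < e) (hed : e < d) (hL : L + e ≤ b₀) :
    (∀ s ∈ Icc 0 L, ∀ x, ‖u (s + e) x - u s x‖ ≤ ω) ∧
    (∀ s ∈ Icc 0 L, ∀ x, ‖Torus.timeDerivWithin (Ico 0 T) u (s + e) x - Torus.timeDerivWithin (Ico 0 T) u s x‖ ≤ ω) ∧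
    (∀ s ∈ Icc 0 L, ∀ x, ∀ i j : Fin 3,
      |Torus.partialDeriv j (fun y => u (s + e) y i) x - Torus.partialDeriv j (fun y => u s y i) x| ≤ ω) ∧
    (∀ s ∈ Icc 0 L, ∀ x, |θ (s + e) x - θ s x| ≤ ω) ∧
    (∀ s ∈ Icc 0 L, ∀ x, |Torus.timeDerivWithin (Ico 0 T) θ (s + e) x - Torus.timeDerivWithin (Ico 0 T) θ s x| ≤ ω) ∧
    (∀ s ∈ Icc 0 L, ∀ x, ‖Torus.gradient (θ (s + e)) x - Torus.gradient (θ s) x‖ ≤ ω) := by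
  have key : ∀ s ∈ Icc 0 L, ∀ x : T3, s + e ∈ Icc 0 b₀ ∧ s ∈ Icc 0 b₀ ∧ |s + e - s| < d ∧ Torus.euclidDist x x < d := by
    intro s hs x
    refine ⟨⟨by linarith [hs.1], by linarith [hs.2]⟩, ⟨hs.1, by linarith [hs.2]⟩, ?_, ?_⟩
    · rw [add_sub_cancel_left, abs_of_pos he]; exact hed
    · rw [Torus.euclidDist_self]; exact hd
  refine ⟨fun s hs x => ?_, fun s hs x => ?_, fun s hs x i j => ?_, fun s hs x => ?_, fun s hs x => ?_, fun s hs x => ?_⟩ <;>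
    obtain ⟨h1, h2, h3, h4⟩ := key s hs x <;> have h := H (s + e) h1 s h2 h3 x x h4
  · exact h.1
  · exact h.2.1
  · exact h.2.2.1 i j
  · exact h.2.2.2.1
  · exact h.2.2.2.2.1
  · exact h.2.2.2.2.2

/-- **Space modulus of the shifted velocity gradient.** Same modulus, read at the pairs `((s + e, x), (s + e, y))`,
`d(x, y) < dX`. [folklore] -/
theorem space_modulus {T : ℝ} {u : ℝ → T3 → V3} {θ : ℝ → T3 → ℝ} {b₀ ω d e L : ℝ}
    (H : ∀ s ∈ Icc 0 b₀, ∀ s' ∈ Icc 0 b₀, |s - s'| < d → ∀ x y : T3, Torus.euclidDist x y < d →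
      ‖u s x - u s' y‖ ≤ ω ∧
      ‖Torus.timeDerivWithin (Ico 0 T) u s x - Torus.timeDerivWithin (Ico 0 T) u s' y‖ ≤ ω ∧
      (∀ i j : Fin 3, |Torus.partialDeriv j (fun y => u s y i) x - Torus.partialDeriv j (fun y' => u s' y' i) y| ≤ ω) ∧
      |θ s x - θ s' y| ≤ ω ∧
      |Torus.timeDerivWithin (Ico 0 T) θ s x - Torus.timeDerivWithin (Ico 0 T) θ s' y| ≤ ω ∧
      ‖Torus.gradient (θ s) x - Torus.gradient (θ s') y‖ ≤ ω)
    (hd : 0 < d) (he : 0 ≤ e) (hL : L + e ≤ b₀) :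
    ∀ s ∈ Icc 0 L, ∀ x y : T3, Torus.euclidDist x y < d →
      ∀ i j : Fin 3, |Torus.partialDeriv j (fun y => u (s + e) y i) x - Torus.partialDeriv j (fun y' => u (s + e) y' i) y| ≤ ω := by
  intro s hs x y hxy i j
  have h1 : s + e ∈ Icc 0 b₀ := ⟨by linarith [hs.1], by linarith [hs.2]⟩
  exact (H (s + e) h1 (s + e) h1 (by rw [sub_self, abs_zero]; exact hd) x y hxy).2.2.1 i j

/-! ## §3 The cone fields in the format of the inputs -/

/-- **The second velocity moment of the thresholds is the cone-weighted empirical integral of `vⱼ vₖ`** (the format of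
`WeakStressIsotropyInBand`, cone kernel spelled out). [folklore] -/
theorem Mmom_eq_integral (r : ℝ) {N : ℕ} (w : Config (N + 1) (Fin 3) T3) (x : T3) (j k : Fin 3) :
    Mmom r w x j k =
      ∫ q, 3 / (Real.pi * r ^ 3) * max (1 - Torus.euclidDist q.1 x / r) 0 * (q.2 j * q.2 k) ∂(empiricalMeasure w) := by
  rw [integral_empiricalMeasure]
  rfl

/-- The cone density with the kernel spelled out (definitional). [folklore] -/
theorem rhoC_eq_integral (r : ℝ) {N : ℕ} (w : Config (N + 1) (Fin 3) T3) (x : T3) :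
    rhoC r w x = ∫ q, 3 / (Real.pi * r ^ 3) * max (1 - Torus.euclidDist q.1 x / r) 0 ∂(empiricalMeasure w) := rfl

/-- The cone momentum with the kernel spelled out (definitional). [folklore] -/
theorem momC_eq_integral (r : ℝ) {N : ℕ} (w : Config (N + 1) (Fin 3) T3) (x : T3) :
    momC r w x = ∫ q, (3 / (Real.pi * r ^ 3) * max (1 - Torus.euclidDist q.1 x / r) 0) • q.2 ∂(empiricalMeasure w) := rfl

end Summit.AtomisticToContinuum.HydrodynamicLimit.Theorems.ChaosClosesEulerKineticReduction

end
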